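import Literature.MathematicalPhysics.QuantumFieldTheory.Balaban1983to89.B8Eq106Local

/-!
# `Balaban1983to89.B8Eq178Local` — T. Bałaban, *Spaces of regular gauge field configurations on a lattice and gauge fixing
# conditions*, Commun. Math. Phys. **99** (1985) 75–102 [Balaban1985RegularSpaces] ("B8"), proof of Theorem 4, pp. 89–90: Proposition 10
# of [3] — its OWN conclusions (203)/(204) for `ũ′ᵐ` — applied to the inductive `u₁` on the block tower, and the equivalence
# (1.78) ⇔ (1.79) with its log-domain condition DISCHARGED there (concrete `ℤᵈ` carriers, general background, local hypotheses)

statement-level skeleton of published theorems with citation tags; proofs where landed; nothing here is a claim about the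
Yang–Mills mass gap

PDF held: `paper:balaban1985-cmp99-regular-spaces-gauge-fixing` (journal page = PDF page + 74); pp. 89–90 [PDF 15–16] on the text
layer, p. 88 [PDF 14] as an image (this seat, 2026-08-25); [3] = [Balaban1985Averaging] Proposition 10 (203)–(204) p. 50, (207) p. 50,
(176)–(179) p. 45, as quoted and proved at a general background in `B7Prop10General`.

WHAT IS PRINTED.  p. 89: "The estimates (1.73), (1.74) together with the condition `\overline{R₀u₁ʲ} = 1` on `Λ_j` imply that `u₁`
satisfies (166), (167) [3] on `Bʲ(Λ_j) ⊂ T_{L^{−j}}` with `α₃ = 16dB₁(α₀ + α₁)`, thus for `α₀ + α₁` sufficiently small the assumptions of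
Proposition 10 are satisfied and we have the representation (213) and the bounds (214) [3]."  p. 90: "(…) These conditions [(1.77)]
imply the regularity conditions (176), (177) on `Ω_j ⊂ T_{L^{−j}}` with `4α₄` instead of `α₄`. (…) `u₁` satisfies the conditions (1.29)
and we may write these conditions for `u′u₁` in the following way `ũ′ʲ = \overline{R₀u′u₁ʲ}(\overline{R₀u₁ʲ})⁻¹ = 1` on `Λ_j`,
`j = 0, 1, …, k`, (1.78) or equivalently as `Q′(u₁, λ) = 0` on `𝔅_k`, `λ = (1/i) log u′`, (1.79)".  [3] Proposition 10 p. 50: "for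
arbitrary configurations `U₀, u′, u₁` satisfying (52), (176), (177), (166), (167) … the bounds (203), (204) hold for `j ≦ k`".

WHY THIS FILE.  `B7Prop10General.prop10_general_of52` proves (203)/(204) from GLOBAL hypotheses ((52) everywhere, (176)/(177) for `u′`
everywhere, `u₁ ∈ Λ_k(U₀, α₃)` everywhere); `B8Eq178Averages.cond178_iff_cond179_of52` derives "(1.78) ⇔ (1.79)" from it, globally.  For
B8's inductive `u₁` and its region-wise data ((1.33)/(1.69) on `Ω_j`, (1.77) on `Ω_j`) only the LOCAL form is available; this file
supplies it, in the pattern of `B8Ineq172Concrete` / `B8Eq1115Concrete` / `B8Eq106Local` (clamped background, zero-extended field, clamped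
`λ ∘ π`, global theorem, transfer by the tower congruences), so that the second equation of the system (1.90)/(1.107) ("`u′u₁`
satisfies (1.29)" ⇔ "`Q′(u₁, λ) = 0` on `𝔅_k`") is available for the genuine `u₁` without any global hypothesis.

WHAT THIS FILE PROVES (kernel, 0 sorry, theorems only, no `def`; tower `[tlo L y n, thi L y n]` of `B8Ineq130`, `lo = hi = y`).
* §1 `prop10_local` — (204) `‖ũ′ᵐ(z) − 1‖ ≤ C₆·(4α₄)` at every level-`m` site of the tower and (203) `‖ũ′ᵐ(b₋)⁻¹R(Ū₀ᵐ(b))ũ′ᵐ(b₊) − 1‖ ≤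
  2(4α₄)·Lᵐ·L^{−j}` at every level-`m` bond of the tower, for `u′ = e^{λ}` with (1.77) in the (207)-form on `Bʲ(y)` ONLY and
  `u₁ = glev … j 0` (the gauge fixing of [3] at top level `j`), `U₀` regular on `Bʲ(y)` only, `|B_b| ≤ b` on `Bʲ(y)` only; smallness that of
  `B7Eq167General` (k = j, ⇒ `α₃ = 40d·Lʲb`) and of `prop10_general_of52` at `α₄ ↦ 4α₄`.
* §2 `dom179_local` — at the top site `y`: `‖ũ′ʲ(y) − 1‖ ≤ 2/5 < 1` (the log-domain condition of (1.79), `B8Eq178Averages.util178`).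
* §3 `prop10_local_of_axial`, `dom179_local_of_axial` — the same for the inductive `u₁` itself (any `u₁` with (1.19) on the tower and
  (1.29) at `y`), via `B8Eq106Local.eq106_local`.
* §4 **`restr129_mul_iff_cond179_local`** — for the TYPED multi-domain classes: `u₁` with (1.29) (`Restr129`) and `U₁^{u₁}U₀ ∈ Ax_k`
  (`InAx`), and the LOCAL data in the tower under every `y ∈ Λ_j`, `j ≤ k`: "`u′u₁` satisfies (1.29)" ⇔ (1.79) "`Q′(u₁, λ) = 0` on `𝔅_k`"
  — `B8Eq178Averages.restr129_mul_iff_cond179` with `hdom` DISCHARGED tower by tower.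

READINGS / DECLARED DEVIATIONS: as `B8Eq1115Concrete` ((1.77) in the (207)-form at the scale of `Ω_j`; explicit constants `C₆ = C₅ + 1`,
`α₃ = 40d·Lʲb`; `ℤᵈ` per level; `G ⊂ U1` averaging-closed; `≤` for `<`); device not in print.  NOT CLAIMED: (203)/(204) beyond the tower,
Sect. E, anything of Theorem 4.  Unit `pub-ymgap-dag-n04-b` (YM Track A, node N05 [B8]), 2026-08-25.  Tree API by name only, nothing restated.
-/

noncomputable section

open NormedSpace Finset

namespace Literature.MathematicalPhysics.QuantumFieldTheory.Balaban1983to89.B8Eq178Local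

open B7Prop1Explicit B7Prop2Explicit B7Prop3Flat B7Prop1Local B7Eq92Concrete B7Eq99Concrete B7Eq84Concrete B7Eq167Flat B7Eq167General
open B7Eq170Flat (cj cj_apply val_Rc_eq_cj)
open B7Prop9Flat (SiteBd)
open B7Prop9General (CovBondBd)
open B7Prop10General (utilG C6 C4G prop10_general_of52)
open B7Prop5Flat (bondsIn restr)
open B8Ineq130 (tlo thi tlo_zero thi_zero inBox_of_le)
open B8Ineq132 (Under)
open B8Ineq172Concrete (avgIter_agree_tower glev_congr_tower)
open B8Eq1115Concrete (utilG_congr_tower)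
open B8Eq106Local (under_iff_tower eq106_local)
open B8Eq119TwistedAxial (InAx Restr129)
open B8Eq178Averages (util178 util178_eq_utilG Cond179 restr129_mul_iff_cond179 restr129_iff_uavg)
open B8Eq131Derivation (ax119_iff_ax67)

-- `Site` alone could resolve to the torus sites of `Setup.lean`; re-export the `ℤ^d` sites of `B7Prop1Explicit`.
export B7Prop1Explicit (Site)

variable {d : ℕ}
variable {𝔸 : Type*} [NormedRing 𝔸] [NormOneClass 𝔸] [NormedAlgebra ℂ 𝔸] [CompleteSpace 𝔸]
variable {L : ℕ} {G : Subgroup 𝔸ˣ} {j : ℕ} {y : Site d} {U₀ : Site d → Fin d → 𝔸ˣ} {α₀ α₄ : ℝ} {B : Site d → Fin d → 𝔸} {b : ℝ}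
  {lam : Site d → 𝔸}

/-! ## §1 Proposition 10 of [3] for `(u′, u₁ = glev … j 0)` on the tower, local hypotheses -/

omit [NormOneClass 𝔸] [NormedAlgebra ℂ 𝔸] [CompleteSpace 𝔸] in
/-- The zero extension of the field given on the bonds of a box inherits `|B_b| ≤ b` globally (device). [cite: Balaban1985RegularSpaces, (1.69) p.88] -/
private theorem norm_insCfg_restr_le {lo hi : Site d} (hb : 0 ≤ b)
    (hB : ∀ (x : Site d) (κ : Fin d), InBox lo hi x → InBox lo hi (x + e κ) → ‖B x κ‖ ≤ b) (x : Site d) (κ : Fin d) :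
    ‖insCfg (bondsIn lo hi) (restr (bondsIn lo hi) B) x κ‖ ≤ b := by
  by_cases h : (x, κ) ∈ bondsIn lo hi
  · rw [B7Prop5Flat.insCfg_restr_of_mem _ _ h]
    obtain ⟨hx, hx'⟩ := B7Prop5Flat.mem_bondsIn.mp h
    exact hB x κ hx hx'
  · simp only [insCfg, h, dite_false, norm_zero]
    exact hb

omit [NormOneClass 𝔸] [NormedAlgebra ℂ 𝔸] [CompleteSpace 𝔸] in
/-- (207) for `λ ∘ π` w.r.t. the clamped background from (207) on the bonds of the box (device; cf. `B8Eq1115Concrete`).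
[cite: Balaban1985Averaging, (207) p.50] -/
private theorem h207a_clamp {lo hi : Site d} (hlohi : ∀ i, lo i ≤ hi i) {β : ℝ} (hβ : 0 < β)
    (h : ∀ (x : Site d) (κ : Fin d), InBox lo hi x → InBox lo hi (x + e κ) → ‖cj (U₀ x κ) (lam (x + e κ)) - lam x‖ < β)
    (x : Site d) (κ : Fin d) :
    ‖cj (clampCfg lo hi U₀ x κ) (lam (clamp lo hi (x + e κ))) - lam (clamp lo hi x)‖ < β := by
  by_cases hP : lo κ ≤ x κ ∧ x κ < hi κ
  · have hx := clamp_inBox hlohi x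
    have hxe : InBox lo hi (clamp lo hi x + e κ) := by rw [← clamp_add_e_of hP]; exact clamp_inBox hlohi _
    simp only [clampCfg, hP, and_self, if_true, clamp_add_e_of hP]
    exact h _ κ hx hxe
  · simp only [clampCfg, hP, if_false, clamp_add_e_of_not (hlohi κ) hP, cj_apply, Units.val_one, inv_one, one_mul,
      mul_one, sub_self, norm_zero]
    exact hβ

/-- **(203)/(204) OF [3] ON THE TOWER, LOCAL HYPOTHESES** (B8 pp. 89–90: the assumptions of Proposition 10 — (52) for `U₀`, (176)–(177) for
`u′` from (1.77) "with `4α₄`", (166)–(167) for `u₁` from (1.73)–(1.74) — hold on `Bʲ(Λ_j) ⊂ T_{L^{−j}}`): for `u′ = e^{λ}` with `‖λ(x)‖ < α₄` at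
the sites and `‖R(U₀(b))λ(b₊) − λ(b₋)‖ < α₄L^{−j}` on the bonds of `Bʲ(y)`, `u₁ = glev … j 0` (gauge fixing of `U₁ = e^{B}`, `|B_b| ≤ b` on
`Bʲ(y)`), `U₀` `G`-valued and regular on `Bʲ(y)`, and the displayed smallness (that of `B7Eq167General` at `k = j` and of
`B7Prop10General.prop10_general_of52` at `α₃ = 40d·Lʲb`, `α₄ ↦ 4α₄`): at every level-`m` site `z ∈ Bⁿ(y)` (`n + m = j`),
(204) `‖ũ′ᵐ(z) − 1‖ ≤ C₆·(4α₄)`, and at every level-`m` bond `⟨z, z + e_κ⟩` inside `Bⁿ(y)`, (203)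
`‖ũ′ᵐ(z)⁻¹R(Ū₀ᵐ(z, κ))ũ′ᵐ(z + e_κ) − 1‖ ≤ 2(4α₄)·Lᵐ·L^{−j}`. [cite: Balaban1985RegularSpaces, p.89 (paragraph after (1.76)), (1.77) p.90; Balaban1985Averaging, Proposition 10 (203)–(204) p.50, (207) p.50] -/
theorem prop10_local (hL : 2 ≤ L) (hG : AvgClosed d L G) (hU₀ : ∀ x κ, U₀ x κ ∈ G)
    (hα : 0 < α₀) (hα3 : C0 d * α₀ ≤ 1 / 3) (hα4 : 4 * α₀ ≤ c2' d L)
    (h33 : pdevOn (tlo L y j) (thi L y j) U₀ < α₀ * (((L : ℝ) ^ j)⁻¹) ^ 2) (hb : 0 ≤ b)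
    (h69 : ∀ (x : Site d) (κ : Fin d), InBox (tlo L y j) (thi L y j) x → InBox (tlo L y j) (thi L y j) (x + e κ) → ‖B x κ‖ ≤ b)
    (hsmall : Real.exp (4 * (800 * ((d : ℝ) + 1) ^ 2 * ((d : ℝ) + 4)) * α₀)
      * (1 + 8 * (131072 * ((d : ℝ) + 1) ^ 2) * ((L : ℝ) ^ j * b)) ≤ 2)
    (hc₃ : 2 * ((L : ℝ) ^ j * b) ≤ c3 d L) (hs : 128 * (d : ℝ) * ((L : ℝ) ^ j * b) ≤ 1) (hL1 : 1 ≤ L)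
    (hα₄ : 0 < α₄) (h177b : ∀ x : Site d, InBox (tlo L y j) (thi L y j) x → ‖lam x‖ < α₄)
    (h177a : ∀ (x : Site d) (κ : Fin d), InBox (tlo L y j) (thi L y j) x → InBox (tlo L y j) (thi L y j) (x + e κ) →
      ‖cj (U₀ x κ) (lam (x + e κ)) - lam x‖ < α₄ * ((L : ℝ) ^ j)⁻¹)
    (hα₃' : 40 * d * ((L : ℝ) ^ j * b) ≤ 1 / 50)
    (hs₁ : 10 * C6 d * (4 * α₄) ≤ 1) (hs₂ : 3000 * ((d : ℝ) + 1) * L * (4 * α₄) ≤ 1)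
    (hs₃ : C4G d L * (α₀ + 40 * d * ((L : ℝ) ^ j * b) + 4 * α₄) ≤ 1)
    (hs₄ : 1024 * ((d : ℝ) + 1) * ((d : ℝ) + 4) * L ^ 2 * α₀ ≤ 1) (hs₅ : 32 * ((d : ℝ) + 1) ^ 2 * C6 d * L ^ 2 * α₀ ≤ 1)
    (hs₆ : 16 * d * B7Prop9Flat.C5' d * C6 d * (L : ℝ) ^ 2 * α₀ ≤ 1)
    {m n : ℕ} (hmn : n + m = j) :
    (∀ z : Site d, tlo L y n ≤ z → z ≤ thi L y n →
        ‖((utilG L U₀ (fun x => expUnit (lam x)) (glev L hL1 U₀ (expCfg B) j 0) m z : 𝔸ˣ) : 𝔸) - 1‖ ≤ C6 d * (4 * α₄)) ∧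
      ∀ (z : Site d) (κ : Fin d), tlo L y n ≤ z → z + e κ ≤ thi L y n →
        ‖((((utilG L U₀ (fun x => expUnit (lam x)) (glev L hL1 U₀ (expCfg B) j 0) m z)⁻¹
            * Rc (avgIter L U₀ m z κ) (utilG L U₀ (fun x => expUnit (lam x)) (glev L hL1 U₀ (expCfg B) j 0) m (z + e κ)) : 𝔸ˣ)) : 𝔸)
            - 1‖ ≤ 2 * (4 * α₄) * ((L : ℝ) ^ m * ((L : ℝ) ^ j)⁻¹) := by
  have hlohi : ∀ i, tlo L y j i ≤ thi L y j i := B8Ineq130.tlo_le_thi hL1 le_rfl j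
  have hUU : ∀ x κ, U₀ x κ ∈ U1 𝔸 := fun x κ => hG.le_U1 (hU₀ x κ)
  have hLr : (1 : ℝ) ≤ L := by exact_mod_cast hL1
  have hη1 : ((L : ℝ) ^ j)⁻¹ ≤ 1 := inv_le_one_of_one_le₀ (one_le_pow₀ hLr)
  -- `α₄ ≤ 1/4` from `10·C₆·4α₄ ≤ 1`, `C₆ ≥ 2`
  have hC6 : (2 : ℝ) ≤ C6 d := by unfold C6; linarith [B7Prop10Flat.one_le_C5 (d := d)]
  have hα₄' : α₄ ≤ 1 / 4 := by nlinarith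
  -- the extended data
  set U₀c := clampCfg (tlo L y j) (thi L y j) U₀ with hU₀c_def
  set Bc := insCfg (bondsIn (tlo L y j) (thi L y j)) (restr (bondsIn (tlo L y j) (thi L y j)) B) with hBc_def
  set lamc : Site d → 𝔸 := fun x => lam (clamp (tlo L y j) (thi L y j) x) with hlamc_def
  have hU₀c : ∀ x κ, U₀c x κ ∈ G := clampCfg_mem hU₀
  have h52c : pdev U₀c < α₀ * (((L : ℝ) ^ j)⁻¹) ^ 2 := (pdev_clampCfg_le hlohi hUU).trans_lt h33
  have hBc : ∀ x κ, ‖Bc x κ‖ ≤ b := norm_insCfg_restr_le hb h69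
  have h₀ : AgreeOn (tlo L y j) (thi L y j) U₀ U₀c := (clampCfg_agree U₀).symm
  have h₁ : AgreeOn (tlo L y j) (thi L y j) (expCfg B) (expCfg Bc) := B7Prop5Flat.agreeOn_expCfg (B7Prop5Flat.agreeOn_insCfg_restr _ _ B)
  have h207b : ∀ x : Site d, ‖lamc x‖ < α₄ := fun x => h177b _ (clamp_inBox hlohi x)
  have h207a : ∀ (x : Site d) (κ : Fin d), ‖cj (U₀c x κ) (lamc (x + e κ)) - lamc x‖ < α₄ * ((L : ℝ) ^ j)⁻¹ :=
    h207a_clamp hlohi (by positivity) h177a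
  -- (207) ⇒ (176), (177) with `4α₄` for `u′ᶜ = e^{λ∘π}`
  have h176 : SiteBd (fun x => expUnit (lamc x)) (4 * α₄) := fun x => by
    show ‖((expUnit (lamc x) : 𝔸ˣ) : 𝔸) - 1‖ ≤ 4 * α₄
    rw [val_expUnit]
    exact (B7Eq214.ineq176_of_207 (lamc x) hα₄' (h207b x)).le
  have h177 : CovBondBd U₀c (fun x => expUnit (lamc x)) (4 * α₄ * ((L : ℝ) ^ j)⁻¹) := fun x κ => by
    show ‖((((expUnit (lamc x))⁻¹ * Rc (U₀c x κ) (expUnit (lamc (x + e κ))) : 𝔸ˣ)) : 𝔸) - 1‖ ≤ 4 * α₄ * ((L : ℝ) ^ j)⁻¹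
    rw [Units.val_mul, val_inv_expUnit, val_Rc_eq_cj, val_expUnit, cj_apply]
    exact (B7Eq214.ineq177_of_207 (U₀c x κ) (lamc x) (lamc (x + e κ)) hα₄' hη1 (h207b x) (h207a x κ)).le
  -- `u₁ᶜ ∈ Λ_j(U₀ᶜ, 40d·Lʲb)` globally, and Proposition 10 for the extended data
  have hΛ := inLambda_glev_general hL hG hU₀c hα hα3 hα4 h52c hb hBc hsmall hc₃ hs hL1
  have hα2 : 2 * α₀ ≤ c2' d L := by linarith
  have hP := prop10_general_of52 hL hG hU₀c hα hα3 hα2 h52c h176 h177 hΛ (by positivity) hα₃' (by positivity) hs₁ hs₂ hs₃ hs₄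
    hs₅ hs₆ m (by omega)
  -- transfer to the original data on the tower
  have hu' : ∀ x : Site d, tlo L y j ≤ x → x ≤ thi L y j → (fun x => expUnit (lam x)) x = (fun x => expUnit (lamc x)) x :=
    fun x hx hx' => by simp only [hlamc_def, clamp_of_inBox (inBox_of_le hx hx')]
  have hglev := glev_congr_tower hL1 h₀ h₁ j 0 (by omega)
  refine ⟨fun z hz hz' => ?_, fun z κ hz hzκ => ?_⟩
  · rw [utilG_congr_tower hL1 h₀ hu' hglev m n hmn z hz hz']
    exact hP.2 z
  · have hz' : z ≤ thi L y n := fun i => by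
      have := hzκ i; rw [Pi.add_apply] at this
      have he : 0 ≤ e κ i := by rw [B7Prop1Explicit.e_apply]; split_ifs <;> norm_num
      linarith
    have hzκ' : tlo L y n ≤ z + e κ := fun i => by
      have := hz i; rw [Pi.add_apply]
      have he : 0 ≤ e κ i := by rw [B7Prop1Explicit.e_apply]; split_ifs <;> norm_num
      linarith
    rw [utilG_congr_tower hL1 h₀ hu' hglev m n hmn z hz hz', utilG_congr_tower hL1 h₀ hu' hglev m n hmn (z + e κ) hzκ' hzκ,
      avgIter_agree_tower hL1 h₀ hmn z κ (inBox_of_le hz hz') (inBox_of_le hzκ' hzκ)]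
    exact hP.1 z κ

/-! ## §2 The log-domain condition of (1.79) at the top site -/

/-- **THE DOMAIN CONDITION OF (1.79) AT `y`**: in the setting of `prop10_local`, `‖ũ′ʲ(y) − 1‖ ≤ 2/5 < 1` (so `log ũ′ʲ(y)` = the series (21)
of [3] inverts `exp`; this is the `hdom` of `B8Eq178Averages.cond178_iff_cond179` at the site `y`). [cite: Balaban1985RegularSpaces, (1.78)–(1.79) p.90; Balaban1985Averaging, (204) p.49, (21) p.21] -/
theorem dom179_local (hL : 2 ≤ L) (hG : AvgClosed d L G) (hU₀ : ∀ x κ, U₀ x κ ∈ G)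
    (hα : 0 < α₀) (hα3 : C0 d * α₀ ≤ 1 / 3) (hα4 : 4 * α₀ ≤ c2' d L)
    (h33 : pdevOn (tlo L y j) (thi L y j) U₀ < α₀ * (((L : ℝ) ^ j)⁻¹) ^ 2) (hb : 0 ≤ b)
    (h69 : ∀ (x : Site d) (κ : Fin d), InBox (tlo L y j) (thi L y j) x → InBox (tlo L y j) (thi L y j) (x + e κ) → ‖B x κ‖ ≤ b)
    (hsmall : Real.exp (4 * (800 * ((d : ℝ) + 1) ^ 2 * ((d : ℝ) + 4)) * α₀)
      * (1 + 8 * (131072 * ((d : ℝ) + 1) ^ 2) * ((L : ℝ) ^ j * b)) ≤ 2)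
    (hc₃ : 2 * ((L : ℝ) ^ j * b) ≤ c3 d L) (hs : 128 * (d : ℝ) * ((L : ℝ) ^ j * b) ≤ 1) (hL1 : 1 ≤ L)
    (hα₄ : 0 < α₄) (h177b : ∀ x : Site d, InBox (tlo L y j) (thi L y j) x → ‖lam x‖ < α₄)
    (h177a : ∀ (x : Site d) (κ : Fin d), InBox (tlo L y j) (thi L y j) x → InBox (tlo L y j) (thi L y j) (x + e κ) →
      ‖cj (U₀ x κ) (lam (x + e κ)) - lam x‖ < α₄ * ((L : ℝ) ^ j)⁻¹)
    (hα₃' : 40 * d * ((L : ℝ) ^ j * b) ≤ 1 / 50)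
    (hs₁ : 10 * C6 d * (4 * α₄) ≤ 1) (hs₂ : 3000 * ((d : ℝ) + 1) * L * (4 * α₄) ≤ 1)
    (hs₃ : C4G d L * (α₀ + 40 * d * ((L : ℝ) ^ j * b) + 4 * α₄) ≤ 1)
    (hs₄ : 1024 * ((d : ℝ) + 1) * ((d : ℝ) + 4) * L ^ 2 * α₀ ≤ 1) (hs₅ : 32 * ((d : ℝ) + 1) ^ 2 * C6 d * L ^ 2 * α₀ ≤ 1)
    (hs₆ : 16 * d * B7Prop9Flat.C5' d * C6 d * (L : ℝ) ^ 2 * α₀ ≤ 1) :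
    ‖util178 L U₀ (fun x => expUnit (lam x)) (glev L hL1 U₀ (expCfg B) j 0) j y - 1‖ < 1 := by
  have h := (prop10_local hL hG hU₀ hα hα3 hα4 h33 hb h69 hsmall hc₃ hs hL1 hα₄ h177b h177a hα₃' hs₁ hs₂ hs₃ hs₄ hs₅ hs₆
    (m := j) (n := 0) (by omega)).1 y (by rw [tlo_zero]) (by rw [thi_zero])
  rw [util178_eq_utilG]
  have hC6 : 0 < C6 d := by unfold C6; linarith [B7Prop10Flat.one_le_C5 (d := d)]
  calc ‖((utilG L U₀ (fun x => expUnit (lam x)) (glev L hL1 U₀ (expCfg B) j 0) j y : 𝔸ˣ) : 𝔸) - 1‖ ≤ C6 d * (4 * α₄) := h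
    _ < 1 := by nlinarith

/-! ## §3 … for the inductive `u₁` itself -/

/-- **THE DOMAIN CONDITION OF (1.79) FOR `u₁` ITSELF**: as `dom179_local`, for any `u₁` bringing `U₁ = e^{B}` to the block axial gauge (1.19) on the
tower under `y` with (1.29) at `y` (B8's inductive `u₁`; `B8Eq106Local.eq106_local`). [cite: Balaban1985RegularSpaces, (1.78)–(1.79) p.90, p.88; Balaban1985Averaging, (204) p.49] -/
theorem dom179_local_of_axial (hL : 2 ≤ L) (hG : AvgClosed d L G) (hU₀ : ∀ x κ, U₀ x κ ∈ G)
    (hα : 0 < α₀) (hα3 : C0 d * α₀ ≤ 1 / 3) (hα4 : 4 * α₀ ≤ c2' d L)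
    (h33 : pdevOn (tlo L y j) (thi L y j) U₀ < α₀ * (((L : ℝ) ^ j)⁻¹) ^ 2) (hb : 0 ≤ b)
    (h69 : ∀ (x : Site d) (κ : Fin d), InBox (tlo L y j) (thi L y j) x → InBox (tlo L y j) (thi L y j) (x + e κ) → ‖B x κ‖ ≤ b)
    (hsmall : Real.exp (4 * (800 * ((d : ℝ) + 1) ^ 2 * ((d : ℝ) + 4)) * α₀)
      * (1 + 8 * (131072 * ((d : ℝ) + 1) ^ 2) * ((L : ℝ) ^ j * b)) ≤ 2)
    (hc₃ : 2 * ((L : ℝ) ^ j * b) ≤ c3 d L) (hs : 128 * (d : ℝ) * ((L : ℝ) ^ j * b) ≤ 1) (hL1 : 1 ≤ L)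
    (hα₄ : 0 < α₄) (h177b : ∀ x : Site d, InBox (tlo L y j) (thi L y j) x → ‖lam x‖ < α₄)
    (h177a : ∀ (x : Site d) (κ : Fin d), InBox (tlo L y j) (thi L y j) x → InBox (tlo L y j) (thi L y j) (x + e κ) →
      ‖cj (U₀ x κ) (lam (x + e κ)) - lam x‖ < α₄ * ((L : ℝ) ^ j)⁻¹)
    (hα₃' : 40 * d * ((L : ℝ) ^ j * b) ≤ 1 / 50)
    (hs₁ : 10 * C6 d * (4 * α₄) ≤ 1) (hs₂ : 3000 * ((d : ℝ) + 1) * L * (4 * α₄) ≤ 1)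
    (hs₃ : C4G d L * (α₀ + 40 * d * ((L : ℝ) ^ j * b) + 4 * α₄) ≤ 1)
    (hs₄ : 1024 * ((d : ℝ) + 1) * ((d : ℝ) + 4) * L ^ 2 * α₀ ≤ 1) (hs₅ : 32 * ((d : ℝ) + 1) ^ 2 * C6 d * L ^ 2 * α₀ ≤ 1)
    (hs₆ : 16 * d * B7Prop9Flat.C5' d * C6 d * (L : ℝ) ^ 2 * α₀ ≤ 1)
    {u₁ : Site d → 𝔸ˣ}
    (hax : ∀ n, n < j → ∀ z : Site d, Under L (j - (n + 1)) y z → ∀ r : Fin d → Fin L,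
      tHol (avgIter L U₀ n) (tildIter L U₀ (mgauge U₀ u₁ (expCfg B)) n) ((L : ℤ) • z) (treeWord (boxVec L r)) = 1)
    (h129 : uavg L U₀ u₁ j y = 1) :
    ‖util178 L U₀ (fun x => expUnit (lam x)) u₁ j y - 1‖ < 1 := by
  have hu : ∀ x : Site d, tlo L y j ≤ x → x ≤ thi L y j → u₁ x = glev L hL1 U₀ (expCfg B) j 0 x := fun x hx hx' =>
    eq106_local L hL1 U₀ (expCfg B) u₁ j y hax h129 x ((under_iff_tower L j y x).2 ⟨hx, hx'⟩)
  rw [util178_eq_utilG, utilG_congr_tower hL1 (U₀' := U₀) (fun _ _ _ _ => rfl) (fun _ _ _ => rfl) hu j 0 (by omega) y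
    (by rw [tlo_zero]) (by rw [thi_zero]), ← util178_eq_utilG]
  exact dom179_local hL hG hU₀ hα hα3 hα4 h33 hb h69 hsmall hc₃ hs hL1 hα₄ h177b h177a hα₃' hs₁ hs₂ hs₃ hs₄ hs₅ hs₆

/-! ## §4 (1.78) ⇔ (1.79) for the typed multi-domain classes, domain condition discharged tower by tower -/

/-- **«`u₁` satisfies the conditions (1.29) and we may write these conditions for `u′u₁` in the following way (1.78) … or equivalently as
`Q′(u₁, λ) = 0` on `𝔅_k` (1.79)» FOR THE INDUCTIVE `u₁`, NO GLOBAL HYPOTHESIS**: let `u₁` satisfy (1.29) (`Restr129`) and bring `U₁ = e^{B}` to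
the relative axial gauge (1.19) (`InAx` for `U₁^{u₁}U₀`); at every `y ∈ Λ_j`, `j ≤ k`, assume the LOCAL data of `prop10_local` in the tower
`Bʲ(y)` ((1.33), (1.69) as `|B_b| ≤ c·L^{−j}`, (1.77) in the (207)-form) with the `j`-free smallness (`c = B₁(α₀ + α₁)`).  Then
"`u′u₁` satisfies (1.29)" ⇔ "`Q′(u₁, λ) = 0` on `𝔅_k`" (`B8Eq178Averages.restr129_mul_iff_cond179`, its `hdom` supplied by
`dom179_local_of_axial`). [cite: Balaban1985RegularSpaces, (1.78)–(1.79) p.90, (1.29) p.81, (1.19) p.79] -/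
theorem restr129_mul_iff_cond179_local (hL : 2 ≤ L) (hG : AvgClosed d L G) (hU₀ : ∀ x κ, U₀ x κ ∈ G)
    (hα : 0 < α₀) (hα3 : C0 d * α₀ ≤ 1 / 3) (hα4 : 4 * α₀ ≤ c2' d L) (hL1 : 1 ≤ L) (hα₄ : 0 < α₄) {c : ℝ} (hc : 0 ≤ c)
    (hsmall : Real.exp (4 * (800 * ((d : ℝ) + 1) ^ 2 * ((d : ℝ) + 4)) * α₀) * (1 + 8 * (131072 * ((d : ℝ) + 1) ^ 2) * c) ≤ 2)
    (hc₃ : 2 * c ≤ c3 d L) (hs : 128 * (d : ℝ) * c ≤ 1) (hα₃' : 40 * d * c ≤ 1 / 50)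
    (hs₁ : 10 * C6 d * (4 * α₄) ≤ 1) (hs₂ : 3000 * ((d : ℝ) + 1) * L * (4 * α₄) ≤ 1) (hs₃ : C4G d L * (α₀ + 40 * d * c + 4 * α₄) ≤ 1)
    (hs₄ : 1024 * ((d : ℝ) + 1) * ((d : ℝ) + 4) * L ^ 2 * α₀ ≤ 1) (hs₅ : 32 * ((d : ℝ) + 1) ^ 2 * C6 d * L ^ 2 * α₀ ≤ 1)
    (hs₆ : 16 * d * B7Prop9Flat.C5' d * C6 d * (L : ℝ) ^ 2 * α₀ ≤ 1)
    {k : ℕ} {Λ : ℕ → Set (Site d)} {u₁ : Site d → 𝔸ˣ}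
    (h129 : Restr129 L k Λ U₀ u₁) (hAx : InAx L k Λ U₀ (mgauge U₀ u₁ (expCfg B) * U₀))
    (h33 : ∀ j, j ≤ k → ∀ y ∈ Λ j, pdevOn (tlo L y j) (thi L y j) U₀ < α₀ * (((L : ℝ) ^ j)⁻¹) ^ 2)
    (h69 : ∀ j, j ≤ k → ∀ y ∈ Λ j, ∀ (x : Site d) (κ : Fin d), InBox (tlo L y j) (thi L y j) x → InBox (tlo L y j) (thi L y j) (x + e κ) →
      ‖B x κ‖ ≤ c * ((L : ℝ) ^ j)⁻¹)
    (h177b : ∀ j, j ≤ k → ∀ y ∈ Λ j, ∀ x : Site d, InBox (tlo L y j) (thi L y j) x → ‖lam x‖ < α₄)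
    (h177a : ∀ j, j ≤ k → ∀ y ∈ Λ j, ∀ (x : Site d) (κ : Fin d), InBox (tlo L y j) (thi L y j) x →
      InBox (tlo L y j) (thi L y j) (x + e κ) → ‖cj (U₀ x κ) (lam (x + e κ)) - lam x‖ < α₄ * ((L : ℝ) ^ j)⁻¹) :
    Restr129 L k Λ U₀ ((fun x => expUnit (lam x)) * u₁) ↔ Cond179 L k Λ U₀ (fun x => expUnit (lam x)) u₁ := by
  refine restr129_mul_iff_cond179 h129 fun j hjk y hy => ?_
  have hLj : (0 : ℝ) < (L : ℝ) ^ j := by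
    have : (1 : ℝ) ≤ L := by exact_mod_cast hL1
    positivity
  have hkey : (L : ℝ) ^ j * (c * ((L : ℝ) ^ j)⁻¹) = c := by field_simp
  have hb : 0 ≤ c * ((L : ℝ) ^ j)⁻¹ := by positivity
  have h129y : uavg L U₀ u₁ j y = 1 := (restr129_iff_uavg L k Λ U₀ u₁).1 h129 j hjk y hy
  refine dom179_local_of_axial hL hG hU₀ hα hα3 hα4 (h33 j hjk y hy) hb (h69 j hjk y hy) (by rw [hkey]; exact hsmall)
    (by rw [hkey]; exact hc₃) (by rw [hkey]; exact hs) hL1 hα₄ (h177b j hjk y hy) (h177a j hjk y hy) (by rw [hkey]; exact hα₃')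
    hs₁ hs₂ (by rw [hkey]; exact hs₃) hs₄ hs₅ hs₆ (fun n hn z hz r => ?_) h129y
  exact (ax119_iff_ax67 L U₀ (mgauge U₀ u₁ (expCfg B)) n z r).1 (hAx j (by omega) hjk y hy n hn z hz r)

end Literature.MathematicalPhysics.QuantumFieldTheory.Balaban1983to89.B8Eq178Local

end
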